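import Literature.NumberTheory.EllipticCurves.VeluKernelReductionProofs
import Literature.NumberTheory.EllipticCurves.PadicSigmaKohelCriterionProofs
import Literature.NumberTheory.EllipticCurves.FormalGroupDictionaryProofs
import Literature.NumberTheory.EllipticCurves.FormalGroupDenominators
import Mathlib.RingTheory.PowerSeries.Substitution
import Mathlib.RingTheory.PowerSeries.Derivative
import HarnessLib

/-!
# The isogeny at the formal point: `X''(τ) = u²𝒰`, `ψ^*ω'' = γω`, and the summed Lemma 10
# (inputs (V1), (V2), (HL) of Blakestad–Grant's Prop. 13; proofs only)

Trunk T-NT-EC (Literature/NumberTheory/EllipticCurves). Step F5c of the programme towards the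
tree's named fact `WeierstrassCurve.mazur_tate_sigma_existsUnique` along Blakestad–Grant 2023:
`PadicSigmaFunctionalEquationProofs.lean` proves their Prop. 13 from three identities
describing an isogeny `ψ : E → E''` at the formal point; here we derive these identities from
the POLYNOMIAL data of Vélu's isogeny (`VeluNormProofs`, `VeluKernelReductionProofs`,
`VeluLogDerivativeProofs`): a short curve `E : y² = f(x)`, a monic kernel polynomial `D` of
degree `n` (`p = 2n + 1`), Vélu's numerator `U` and `y`-numerator `M = U'D - 2UD'` with
`f·M² = U³ + aUD⁴ + bD⁶` (so `ψ_V = (U/D², yM/D³) : E → E_V : y² = x³ + ax + b`), rescaled by a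
unit `γ`: `E'' : y² = x³ + aγ⁻⁴x + bγ⁻⁶`, `ψ = [γ-scaling] ∘ ψ_V`, formal isogeny
`τ = γ·t_V = t·(γ·𝒟·u)` (`𝒟 = t^{2n}D(x(t))`, `u = 𝒰/(X·ℳ)`, `VeluKernelReductionProofs`).

* `formalXMulSq_subst_isog` (V1): `X''(τ) = u²·𝒰` — the `x`-coordinate of `ψ(T)` is
  `γ⁻²U/D²`, via uniqueness of the solution of `w = s³ + a''sw² + b''w³` (AEC IV.1.1).
* `formalInvDiff_subst_isog_mul` (V2): `W''(τ)·τ' = γ·W` — `ψ^*ω'' = γ·ω`, from `M = U'D - 2UD'`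
  (`d(U/D²)/dx = M/D³`) and `Dx = 2y`.
* `X_mul_derivative_logDeriv_sub` (HL): `t·C' - C = W·(pX - T't² - 𝒰/𝒟²)` for
  `C = 𝒟_{2n}(𝒟)/𝒟 = t·D log D(x(t))`, from the explicit `U = pXD² - 2f'DD' + 4fD'² - 4fDD'' - T'D²`
  (`VeluLogDerivativeProofs.veluU_eq_explicit`) and `D(g(x)) = 2y·g'(x)`
  (`clearedDeriv_clearedEval_eq_derivative`).

## Sources

* C. Blakestad, D. Grant, J. Number Theory 249 (2023) (arXiv:1903.02480), Prop. 7(c), Lemma 10,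
  Lemma 12, proof of Prop. 13. [BlakestadGrant2023]
* J. H. Silverman, *The Arithmetic of Elliptic Curves*, GTM 106 (2009), IV.1.1. [SilvermanAEC2009]
* J. Vélu, C. R. Acad. Sci. Paris 273 (1971) 238–241. [Velu1971]

Pure proof file: no new definitions, no named facts.
-/

noncomputable section

open PowerSeries Literature.NumberTheory.EllipticCurves

namespace WeierstrassCurve

/-! ### `D(g(x)) = 2y·g'(x)`, poles cleared -/

section ClearedCalculus

variable {R : Type*} [CommRing R] (W : WeierstrassCurve R) [W.IsCharNeTwoNF]

/-- **`𝒟_{2(e+1)}(ev_{e+1}(g)) = -2X·ev_e(g')`**: the invariant derivation on `g(x)`,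
`D(g(x)) = g'(x)·Dx = 2y·g'(x)`, poles cleared (`z^{2e+3}·2y·g'(x) = -2X·ev_e(g')`) — the tree's
`clearedDeriv_clearedEval_eq` (`PadicSigmaKohelCriterionProofs`) with the factor `x` taken out.
[Blakestad–Grant 2023, §2 (`Dx = 2y`)] [folklore] -/
theorem clearedDeriv_clearedEval_eq_derivative {e : ℕ} {g : Polynomial R} (hg : g.natDegree ≤ e + 1) :
    W.clearedDeriv (2 * (e + 1)) (W.clearedEval (e + 1) g) =
      -2 * W.formalXMulSq * W.clearedEval e (Polynomial.derivative g) := by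
  rw [W.clearedDeriv_clearedEval_eq hg,
    W.clearedEval_X_mul ((Polynomial.natDegree_derivative_le g).trans (by omega)), mul_assoc]

end ClearedCalculus

/-! ### Over a field of characteristic `0` -/

section FieldCalculus

variable {K : Type*} [Field K] [CharZero K] (W : WeierstrassCurve K) [W.IsCharNeTwoNF]

/-- **`ev₂(f')·W = X·(1 + 2W)`** (`a₁ = a₃ = 0`): `z⁴f'(x(z)) = z⁴·Dy = X(η + 2)` since
`y = -X/z³`, `zX' - 2X = -2XW`. [folklore] -/
theorem clearedEval_derivative_rhsCubic_mul_formalInvDiff :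
    W.clearedEval 2 (Polynomial.derivative W.rhsCubic) * W.formalInvDiff =
      W.formalXMulSq * (1 + 2 * W.formalInvDiff) := by
  have h := W.clearedDeriv_clearedEval_eq_derivative (e := 2) W.natDegree_rhsCubic_le
  rw [clearedEval_rhsCubic_eq_sq, clearedDeriv_def, show ((2 * (2 + 1) : ℕ) : K⟦X⟧) = 6 by norm_num,
    sq, Derivation.leibniz] at h
  simp only [smul_eq_mul] at h
  have hY := W.formalEta_mul_sub_of_isCharNeTwoNF
  have hηW := W.formalEta_mul_formalInvDiff
  -- `-2X·ev₂(f') = 𝒟₆(X²) = -4X² - 2X²η`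
  have h2 : (2 * W.formalXMulSq) * (W.clearedEval 2 (Polynomial.derivative W.rhsCubic) -
      2 * W.formalXMulSq - W.formalXMulSq * W.formalEta) = 0 := by
    linear_combination h - 2 * W.formalXMulSq * hY
  have hX0 : (2 * W.formalXMulSq) ≠ 0 := fun h0 => by
    have h1 := congrArg constantCoeff h0
    rw [map_mul, W.constantCoeff_formalXMulSq, mul_one, map_ofNat, map_zero] at h1
    exact two_ne_zero h1
  have h3 := (mul_eq_zero.mp h2).resolve_left hX0
  linear_combination W.formalInvDiff * h3 + W.formalXMulSq * hηW

end FieldCalculus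


/-! ### (V1) The `x`-coordinate of `ψ(T)`: `X''(τ) = u²·𝒰` -/

section IsogenyData

variable {K : Type*} [Field K] [CharZero K] (W : WeierstrassCurve K) [W.IsCharNeTwoNF]

omit [CharZero K] [W.IsCharNeTwoNF] in
/-- `ev_{kd}(g^k) = ev_d(g)^k`. [folklore] -/
theorem clearedEval_pow {d : ℕ} {g : Polynomial K} (hg : g.natDegree ≤ d) (k : ℕ) :
    W.clearedEval (k * d) (g ^ k) = W.clearedEval d g ^ k := by
  induction k with
  | zero => rw [zero_mul, pow_zero, pow_zero, clearedEval, Polynomial.homogenize_one, pow_zero, map_one]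
  | succ k ih =>
    rw [pow_succ, pow_succ, show (k + 1) * d = k * d + d by ring,
      W.clearedEval_mul (Polynomial.natDegree_pow_le.trans (Nat.mul_le_mul_left k hg)) hg, ih]

omit [CharZero K] [W.IsCharNeTwoNF] in
/-- **Uniqueness of `w(s)`** (AEC IV.1.1(a)): two solutions `Z₁, Z₂ ∈ t·K⟦t⟧` of the short
Weierstrass recursion `Z = s³ + A·s·Z² + B·Z³` (`s ∈ t·K⟦t⟧`) coincide — their difference `d`
satisfies `d = d·q` with `q(0) = 0`. [Silverman AEC IV.1.1(a)] [cite: SilvermanAEC2009, IV.1.1] -/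
theorem eq_of_formalW_recursion {A B : K} {s Z₁ Z₂ : K⟦X⟧} (hs : constantCoeff s = 0)
    (h₁0 : constantCoeff Z₁ = 0) (h₂0 : constantCoeff Z₂ = 0)
    (h₁ : Z₁ = s ^ 3 + C A * s * Z₁ ^ 2 + C B * Z₁ ^ 3) (h₂ : Z₂ = s ^ 3 + C A * s * Z₂ ^ 2 + C B * Z₂ ^ 3) :
    Z₁ = Z₂ := by
  set q := C A * s * (Z₁ + Z₂) + C B * (Z₁ ^ 2 + Z₁ * Z₂ + Z₂ ^ 2) with hq
  have hdq : (Z₁ - Z₂) * (1 - q) = 0 := by rw [hq]; linear_combination h₁ - h₂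
  have hunit : IsUnit (1 - q) := by
    refine PowerSeries.isUnit_iff_constantCoeff.mpr ?_
    rw [map_sub, map_one, hq, map_add, map_mul, map_mul, hs, mul_zero, zero_mul, zero_add, map_mul, map_add,
      map_add, map_pow, map_mul, map_pow, h₁0, h₂0]
    norm_num
  exact sub_eq_zero.mp ((hunit.mul_left_eq_zero).mp hdq)

omit [CharZero K] in
/-- **(V1) `X''(τ) = u²·𝒰`: the `x`-coordinate of the image of the formal point.** For the
short curve `E : y² = f(x)`, polynomials `U, M, D` (`deg D ≤ n` with `D_n = 1`, `deg U ≤ p`,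
`M` monic of degree `3n`) with **`f·M² = U³ + a·U·D⁴ + b·D⁶`** (so
`ψ_V = (U/D², yM/D³) : E → E_V : y² = x³ + ax + b`), constants `A₂γ⁴ = a`, `B₂γ⁶ = b`
(`E'' : y² = x³ + A₂x + B₂`, the `γ`-rescaling of `E_V`), and the formal isogeny
`τ = t·(γ·𝒟·u)` (`𝒟 = ev_n(D)`, `u = 𝒰/(Xℳ)`; `VeluKernelReductionProofs`): the cleared
`x`-series of `E''` at `τ` is `u²𝒰`, i.e. `x''(ψ(T)) = X''(τ)/τ² = γ⁻²U(x(t))/D(x(t))²`.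
Proof: `w̃ = γ³t³𝒟³/(Xℳ)` (`= -1/y''(ψ(T))`) solves `w = τ³ + A₂τw² + B₂w³` by the cleared
identity `X²ℳ² = 𝒰³ + at⁴𝒰𝒟⁴ + bt⁶𝒟⁶`, hence equals `w''(τ)` (AEC IV.1.1(a) uniqueness), and
`X'' = s³/w''`. [Blakestad–Grant 2023, Prop. 7(c); Silverman AEC IV.1.1]
[cite: BlakestadGrant2023, Prop. 7] -/
theorem formalXMulSq_subst_isog {U M D : Polynomial K} {a b A₂ B₂ γ : K} {p n : ℕ} (hp : 2 * n + 1 = p)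
    (hγ : γ ≠ 0) (hD : D.natDegree ≤ n) (hD1 : D.coeff n = 1) (hU : U.natDegree ≤ p)
    (hM : M.natDegree ≤ 3 * n) (hM1 : M.coeff (3 * n) = 1)
    (hid : W.rhsCubic * M ^ 2 = U ^ 3 + Polynomial.C a * U * D ^ 4 + Polynomial.C b * D ^ 6)
    (hA₂ : A₂ * γ ^ 4 = a) (hB₂ : B₂ * γ ^ 6 = b) :
    (⟨0, 0, 0, A₂, B₂⟩ : WeierstrassCurve K).formalXMulSq.subst
        (X * (C γ * W.clearedEval n D * W.veluFormalUnit U M p n)) =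
      W.veluFormalUnit U M p n ^ 2 * W.clearedEval p U := by
  set W₂ : WeierstrassCurve K := ⟨0, 0, 0, A₂, B₂⟩ with hW₂
  set Xs := W.formalXMulSq with hXs
  set 𝒟c := W.clearedEval n D with h𝒟c
  set 𝒰 := W.clearedEval p U with h𝒰
  set ℳ := W.clearedEval (3 * n) M with hℳ
  set ι := (Xs * ℳ).invOfUnit 1 with hιdef
  set u := W.veluFormalUnit U M p n with hudef
  have hu : u = 𝒰 * ι := rfl
  have hι : Xs * ℳ * ι = 1 :=
    PowerSeries.mul_invOfUnit _ _ (by rw [constantCoeff_formalXMulSq_mul_clearedEval hM hM1, Units.val_one])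
  have h𝒟c0 : constantCoeff 𝒟c = 1 := by rw [h𝒟c, W.constantCoeff_clearedEval hD, hD1]
  -- the cleared identity `X²ℳ² = 𝒰³ + a t⁴ 𝒰 𝒟⁴ + b t⁶ 𝒟⁶`
  have hidc : Xs ^ 2 * ℳ ^ 2 = 𝒰 ^ 3 + C a * X ^ 4 * 𝒰 * 𝒟c ^ 4 + C b * X ^ 6 * 𝒟c ^ 6 := by
    have h := congrArg (W.clearedEval (6 * n + 3)) hid
    have hM2 : (M ^ 2).natDegree ≤ 2 * (3 * n) := Polynomial.natDegree_pow_le.trans (Nat.mul_le_mul_left 2 hM)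
    have haU : (Polynomial.C a * U).natDegree ≤ p := (Polynomial.natDegree_C_mul_le _ _).trans hU
    have hD4 : (D ^ 4).natDegree ≤ 4 * n := Polynomial.natDegree_pow_le.trans (Nat.mul_le_mul_left 4 hD)
    have hD6 : (D ^ 6).natDegree ≤ 6 * n := Polynomial.natDegree_pow_le.trans (Nat.mul_le_mul_left 6 hD)
    rw [show 6 * n + 3 = 3 + 2 * (3 * n) by ring, W.clearedEval_mul W.natDegree_rhsCubic_le hM2, clearedEval_pow _ hM,
      clearedEval_rhsCubic_eq_sq, clearedEval_add, clearedEval_add,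
      show 3 + 2 * (3 * n) = 3 * p by omega, clearedEval_pow _ hU,
      show 3 * p = (p + 4 * n) + 2 by omega,
      W.clearedEval_add_right 2 ((Polynomial.natDegree_mul_le.trans (add_le_add haU hD4))),
      W.clearedEval_mul haU hD4, clearedEval_C_mul, clearedEval_pow _ hD,
      show p + 4 * n + 2 = 6 * n + 3 by omega,
      W.clearedEval_add_right 3 (((Polynomial.natDegree_C_mul_le _ _).trans hD6)), clearedEval_C_mul,
      clearedEval_pow _ hD] at h
    linear_combination h
  -- the substitution `τ = t·γ𝒟u`
  set v := C γ * 𝒟c * u with hv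
  have hτ0 : constantCoeff (X * v) = 0 := by rw [map_mul, constantCoeff_X, zero_mul]
  have hτ : HasSubst (X * v) := HasSubst.of_constantCoeff_zero' hτ0
  set τ := X * v with hτdef
  -- `w''(τ)` solves the recursion
  have hC : ∀ c : K, (C c).subst τ = C c := fun c => PowerSeries.subst_C c
  set w₂τ := W₂.formalW.subst τ with hw₂τ
  have hrec₂ : w₂τ = τ ^ 3 + C A₂ * τ * w₂τ ^ 2 + C B₂ * w₂τ ^ 3 := by
    have h := congrArg (PowerSeries.subst τ) W₂.formalWStep_formalW
    rw [formalWStep] at h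
    simp only [hW₂, map_zero, zero_mul, add_zero, subst_add hτ, subst_mul hτ, subst_pow hτ, hC,
      subst_X hτ] at h
    exact h.symm
  -- `w̃ = γ³t³𝒟³/(Xℳ)` solves the recursion
  set wt := C γ ^ 3 * X ^ 3 * 𝒟c ^ 3 * ι with hwt
  have hA₂' : C A₂ * C γ ^ 4 = (C a : K⟦X⟧) := by rw [← map_pow, ← map_mul, hA₂]
  have hB₂' : C B₂ * C γ ^ 6 = (C b : K⟦X⟧) := by rw [← map_pow, ← map_mul, hB₂]
  have hrec : wt = τ ^ 3 + C A₂ * τ * wt ^ 2 + C B₂ * wt ^ 3 := by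
    rw [hwt, hτdef, hv, hu]
    linear_combination (C γ ^ 3 * X ^ 3 * 𝒟c ^ 3 * ι ^ 3) * hidc
      - C γ ^ 3 * X ^ 3 * 𝒟c ^ 3 * ι * (ι * Xs * ℳ + 1) * hι
      - X ^ 7 * 𝒟c ^ 7 * 𝒰 * ι ^ 3 * C γ ^ 3 * hA₂' - X ^ 9 * 𝒟c ^ 9 * ι ^ 3 * C γ ^ 3 * hB₂'
  -- hence `w''(τ) = w̃`
  have hw0 : constantCoeff w₂τ = 0 := by
    rw [hw₂τ, constantCoeff_subst_of_constantCoeff_eq_zero hτ0, ← coeff_zero_eq_constantCoeff_apply,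
      W₂.coeff_formalW_of_lt_three (by norm_num)]
  have hwt0 : constantCoeff wt = 0 := by
    rw [hwt]; simp
  have heq : w₂τ = wt := eq_of_formalW_recursion hτ0 hw0 hwt0 hrec₂ hrec
  -- `X''(τ)·B''(τ) = 1`, `w''(τ) = τ³B''(τ)`
  set Bτ := W₂.formalWDivCube.subst τ with hBτ
  have hXB : W₂.formalXMulSq.subst τ * Bτ = 1 := by
    have h := congrArg (PowerSeries.subst τ) W₂.formalWDivCube_mul_formalXMulSq
    rw [subst_mul hτ, ← coe_substAlgHom hτ, map_one, coe_substAlgHom hτ] at h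
    rw [mul_comm]; exact h
  have hwB : w₂τ = τ ^ 3 * Bτ := by
    rw [hw₂τ, W₂.formalW_eq_X_pow_mul_formalWDivCube, subst_mul hτ, subst_pow hτ, subst_X hτ]
  -- `ι = u³·B''(τ)`
  have hιB : ι = u ^ 3 * Bτ := by
    have h : X ^ 3 * (C γ ^ 3 * 𝒟c ^ 3 * (ι - u ^ 3 * Bτ)) = 0 := by
      have h1 := heq.symm.trans hwB
      rw [hwt, hτdef, hv] at h1
      linear_combination h1
    have hX3 : (X : K⟦X⟧) ^ 3 ≠ 0 := pow_ne_zero 3 X_ne_zero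
    have hγ3 : (C γ : K⟦X⟧) ^ 3 ≠ 0 := pow_ne_zero 3 (by
      intro h0; exact hγ (by simpa using congrArg constantCoeff h0))
    have h𝒟c3 : 𝒟c ^ 3 ≠ 0 := pow_ne_zero 3 (by
      intro h0; have := congrArg constantCoeff h0; rw [h𝒟c0, map_zero] at this; exact one_ne_zero this)
    have h2 := (mul_eq_zero.mp h).resolve_left hX3
    have h3 := (mul_eq_zero.mp h2).resolve_left (mul_ne_zero hγ3 h𝒟c3)
    exact sub_eq_zero.mp h3
  -- conclude
  calc W₂.formalXMulSq.subst τ = W₂.formalXMulSq.subst τ * (Xs * ℳ * ι) := by rw [hι, mul_one]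
    _ = (W₂.formalXMulSq.subst τ * Bτ) * u ^ 2 * (u * (Xs * ℳ)) := by rw [hιB]; ring
    _ = u ^ 2 * 𝒰 := by
      rw [hXB, one_mul, hu, mul_assoc, mul_comm ι, hι, mul_one]

/-! ### (V2) `ψ^*ω'' = γ·ω`: `W''(τ)·τ' = γ·W` -/

omit [CharZero K] in
/-- `zF' - M·F = -2X·ev·W`-form of `clearedDeriv_clearedEval_eq_derivative`: for `deg g ≤ e + 1`,
`z·(ev_{e+1}g)' - 2(e+1)·ev_{e+1}g = -2X·ev_e(g')·W`. [folklore] -/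
theorem X_mul_derivative_clearedEval_sub {e : ℕ} {g : Polynomial K} (hg : g.natDegree ≤ e + 1) :
    X * d⁄dX K (W.clearedEval (e + 1) g) - ((2 * (e + 1) : ℕ) : K⟦X⟧) * W.clearedEval (e + 1) g =
      -2 * W.formalXMulSq * W.clearedEval e (Polynomial.derivative g) * W.formalInvDiff := by
  have h := W.clearedDeriv_clearedEval_eq_derivative hg
  rw [clearedDeriv_def] at h
  have hηW := W.formalEta_mul_formalInvDiff
  linear_combination W.formalInvDiff * h -
    (X * d⁄dX K (W.clearedEval (e + 1) g) - ((2 * (e + 1) : ℕ) : K⟦X⟧) * W.clearedEval (e + 1) g) * hηW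

/-- **(V2) `ψ^*ω'' = γ·ω` at the formal point: `W''(τ)·τ' = γ·W(t)`.** With the data of
`formalXMulSq_subst_isog` and Vélu's `M = U'D - 2UD'` (`d(U/D²) = M/D³·dx`, so that
`ψ_V^*(dx_V/2y_V) = (M/D³)dx/(2yM/D³) = dx/2y`, and the `γ`-rescaling multiplies `ω` by `γ`):
differentiating `X''(τ) = u²𝒰` and using `zX' - 2X = -2XW` on both curves.
[Blakestad–Grant 2023, Prop. 7(c) ("`ψ^*(ω_{p/H}) = (p/H)ω`"); Vélu 1971]
[cite: BlakestadGrant2023, Prop. 7] -/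
theorem formalInvDiff_subst_isog_mul {U M D : Polynomial K} {a b A₂ B₂ γ : K} {p n : ℕ} (hp : 2 * n + 1 = p)
    (hn : 1 ≤ n) (hγ : γ ≠ 0) (hD : D.natDegree ≤ n) (hD1 : D.coeff n = 1) (hU : U.natDegree ≤ p)
    (hU1 : U.coeff p = 1) (hM : M.natDegree ≤ 3 * n) (hM1 : M.coeff (3 * n) = 1)
    (hMU : M = Polynomial.derivative U * D - 2 * U * Polynomial.derivative D)
    (hid : W.rhsCubic * M ^ 2 = U ^ 3 + Polynomial.C a * U * D ^ 4 + Polynomial.C b * D ^ 6)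
    (hA₂ : A₂ * γ ^ 4 = a) (hB₂ : B₂ * γ ^ 6 = b) :
    (⟨0, 0, 0, A₂, B₂⟩ : WeierstrassCurve K).formalInvDiff.subst
        (X * (C γ * W.clearedEval n D * W.veluFormalUnit U M p n)) *
        d⁄dX K (X * (C γ * W.clearedEval n D * W.veluFormalUnit U M p n)) = C γ * W.formalInvDiff := by
  have hV1 := W.formalXMulSq_subst_isog hp hγ hD hD1 hU hM hM1 hid hA₂ hB₂
  set W₂ : WeierstrassCurve K := ⟨0, 0, 0, A₂, B₂⟩ with hW₂
  haveI : W₂.IsCharNeTwoNF := ⟨rfl, rfl⟩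
  obtain ⟨e, rfl⟩ : ∃ e, n = e + 1 := ⟨n - 1, by omega⟩
  set Xs := W.formalXMulSq with hXs
  set Wd := W.formalInvDiff with hWd
  set 𝒟c := W.clearedEval (e + 1) D with h𝒟c
  set 𝒟c₁ := W.clearedEval e (Polynomial.derivative D) with h𝒟c₁
  set 𝒰 := W.clearedEval p U with h𝒰
  set 𝒰₁ := W.clearedEval (p - 1) (Polynomial.derivative U) with h𝒰₁
  set ℳ := W.clearedEval (3 * (e + 1)) M with hℳ
  set ι := (Xs * ℳ).invOfUnit 1 with hιdef
  set u := W.veluFormalUnit U M p (e + 1) with hudef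
  have hu : u = 𝒰 * ι := rfl
  have hι : Xs * ℳ * ι = 1 :=
    PowerSeries.mul_invOfUnit _ _ (by rw [constantCoeff_formalXMulSq_mul_clearedEval hM hM1, Units.val_one])
  have R_u : u * Xs * ℳ = 𝒰 := by rw [hu]; linear_combination 𝒰 * hι
  -- cleared relations
  have R𝒰 : X * d⁄dX K 𝒰 - ((2 * (p - 1 + 1) : ℕ) : K⟦X⟧) * 𝒰 = -2 * Xs * 𝒰₁ * Wd := by
    have hU' : U.natDegree ≤ (p - 1) + 1 := by omega
    have := W.X_mul_derivative_clearedEval_sub hU'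
    rwa [show p - 1 + 1 = p by omega] at this ⊢
  have R𝒟 : X * d⁄dX K 𝒟c - ((2 * (e + 1) : ℕ) : K⟦X⟧) * 𝒟c = -2 * Xs * 𝒟c₁ * Wd :=
    W.X_mul_derivative_clearedEval_sub hD
  have RM : ℳ = 𝒰₁ * 𝒟c - 2 * 𝒰 * 𝒟c₁ := by
    have hU'deg : (Polynomial.derivative U).natDegree ≤ p - 1 :=
      (Polynomial.natDegree_derivative_le U).trans (by omega)
    have hD'deg : (Polynomial.derivative D).natDegree ≤ e :=
      (Polynomial.natDegree_derivative_le D).trans (by omega)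
    rw [hℳ, hMU, clearedEval_sub, show 3 * (e + 1) = (p - 1) + (e + 1) by omega, W.clearedEval_mul hU'deg hD,
      show (2 : Polynomial K) * U * Polynomial.derivative D = Polynomial.C 2 * (U * Polynomial.derivative D) by
        rw [Polynomial.C_ofNat]; ring,
      clearedEval_C_mul, show p - 1 + (e + 1) = p + e by omega, W.clearedEval_mul hU hD'deg, map_ofNat]
    ring
  have hpc : ((2 * (p - 1 + 1) : ℕ) : K⟦X⟧) = 2 * ((2 * (e + 1) : ℕ) : K⟦X⟧) + 2 := by
    push_cast [show p - 1 + 1 = p by omega, ← hp]; ring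
  -- the substitution
  set v := C γ * 𝒟c * u with hv
  have hτ0 : constantCoeff (X * v) = 0 := by rw [map_mul, constantCoeff_X, zero_mul]
  have hτ : HasSubst (X * v) := HasSubst.of_constantCoeff_zero' hτ0
  set τ := X * v with hτdef
  set H := W₂.formalXMulSq.subst τ with hH
  -- `τ·(X'')(τ) - 2H = -2H·W''(τ)` and the chain rule
  have hsub : τ * (d⁄dX K W₂.formalXMulSq).subst τ - 2 * H = -2 * H * W₂.formalInvDiff.subst τ := by
    have h2 := W₂.formalEta_mul_sub_of_isCharNeTwoNF
    have hηW₂ := W₂.formalEta_mul_formalInvDiff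
    have h3 : X * d⁄dX K W₂.formalXMulSq - C (2 : K) * W₂.formalXMulSq =
        C (-2 : K) * W₂.formalXMulSq * W₂.formalInvDiff := by
      rw [map_neg, map_ofNat]
      linear_combination W₂.formalInvDiff * h2 - (X * d⁄dX K W₂.formalXMulSq - 2 * W₂.formalXMulSq) * hηW₂
    have h := congrArg (PowerSeries.subst τ) h3
    have hC : ∀ c : K, (C c).subst τ = C c := fun c => PowerSeries.subst_C c
    rw [subst_sub hτ, subst_mul hτ, subst_X hτ, subst_mul hτ, subst_mul hτ, subst_mul hτ, hC, hC, map_neg,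
      map_ofNat] at h
    linear_combination h
  have hchain : d⁄dX K H = (d⁄dX K W₂.formalXMulSq).subst τ * d⁄dX K τ := derivative_subst K hτ
  -- the key identity `τ·H' = 2H(τ' - γW)` for `H = u²𝒰`
  have hdτ : d⁄dX K τ = v + X * (C γ * (d⁄dX K 𝒟c * u + 𝒟c * d⁄dX K u)) := by
    rw [hτdef, Derivation.leibniz, derivative_X, smul_eq_mul, smul_eq_mul, mul_one, add_comm, hv, Derivation.leibniz,
      Derivation.leibniz, derivative_C, smul_zero, add_zero, smul_eq_mul, smul_eq_mul, smul_eq_mul]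
    ring
  have hdH : d⁄dX K H = 2 * u * d⁄dX K u * 𝒰 + u ^ 2 * d⁄dX K 𝒰 := by
    rw [hV1, sq, Derivation.leibniz, Derivation.leibniz, smul_eq_mul, smul_eq_mul, smul_eq_mul]; ring
  have key : τ * d⁄dX K H = 2 * H * (d⁄dX K τ - C γ * Wd) := by
    rw [hdH, hdτ, hV1, hτdef, hv]
    linear_combination C γ * u ^ 2 * (u * 𝒟c * R𝒰 - 2 * u * 𝒰 * R𝒟 + 2 * u * Xs * Wd * RM - 2 * Wd * R_u +
      u * 𝒰 * 𝒟c * hpc)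
  -- conclude: `2H·(W''(τ)τ' - γW) = 0`
  have hH0 : (2 * H) ≠ 0 := fun h0 => by
    have h1 := congrArg constantCoeff h0
    have hι0 : constantCoeff ι = 1 := by
      rw [hιdef, PowerSeries.constantCoeff_invOfUnit, inv_one, Units.val_one]
    rw [map_mul, hV1, map_mul, map_pow, hu, map_mul, hι0, h𝒰, W.constantCoeff_clearedEval hU, hU1, map_ofNat,
      map_zero] at h1
    norm_num at h1
  have hfin : 2 * H * (W₂.formalInvDiff.subst τ * d⁄dX K τ - C γ * Wd) = 0 := by
    have h := congrArg (· * d⁄dX K τ) hsub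
    linear_combination h - key + τ * hchain
  exact sub_eq_zero.mp ((mul_eq_zero.mp hfin).resolve_left hH0)

/-! ### (HL) Lemma 10 summed: `t·C' - C = W·(pX - T't² - 𝒰/𝒟²)` -/

/-- **(HL) `D(Dφ_ψ(x)/φ_ψ(x)) = px - x₁ - T'(x)` at the formal point, cleared.** With
`C := 𝒟_{2n}(𝒟)/𝒟 = t·D log D(x(t))` (`𝒟 = ev_n(D)`, `D` the kernel polynomial, `D_n = 1`,
`n ≥ 2`) and Vélu's numerator in the explicit form
`U = pXD² - 2f'DD' + 4fD'² - 4fDD'' - T'D²` (`VeluLogDerivativeProofs.veluU_eq_explicit`):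

  `t·C' - C = W·(p·X - T'·t² - 𝒰/𝒟²)`   (`𝒰 = ev_p(U)`, `p = 2n + 1`),

i.e. `t²W·D(D log D(x(t))) = W·(pX - T't² - t²x₁(t))`. Ingredients: `D(g(x)) = 2y g'(x)`
(`X_mul_derivative_clearedEval_sub`) for `D, D'` and `X`, and `ev₂(f')W = X(1 + 2W)`.
[Blakestad–Grant 2023, Lemma 10 and proof of Prop. 13] [cite: BlakestadGrant2023, Lemma 10] -/
theorem X_mul_derivative_logDeriv_sub {U D : Polynomial K} {T' : K} {p n : ℕ} (hp : 2 * n + 1 = p) (hn : 2 ≤ n)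
    (hD : D.natDegree ≤ n) (hD1 : D.coeff n = 1)
    (hUexp : U = Polynomial.C (p : K) * Polynomial.X * D ^ 2
      - 2 * Polynomial.derivative W.rhsCubic * D * Polynomial.derivative D
      + 4 * W.rhsCubic * Polynomial.derivative D ^ 2
      - 4 * W.rhsCubic * D * Polynomial.derivative (Polynomial.derivative D)
      - Polynomial.C T' * D ^ 2) :
    X * d⁄dX K (W.clearedDeriv (2 * n) (W.clearedEval n D) * (W.clearedEval n D).invOfUnit 1) -
        W.clearedDeriv (2 * n) (W.clearedEval n D) * (W.clearedEval n D).invOfUnit 1 =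
      W.formalInvDiff * (C (p : K) * W.formalXMulSq - C T' * X ^ 2 -
        W.clearedEval p U * (W.clearedEval n D).invOfUnit 1 ^ 2) := by
  obtain ⟨e, rfl⟩ : ∃ e, n = e + 2 := ⟨n - 2, by omega⟩
  subst hp
  set Xs := W.formalXMulSq with hXs
  set Wd := W.formalInvDiff with hWd
  set f := W.rhsCubic with hf
  set 𝒟c := W.clearedEval (e + 2) D with h𝒟c
  set 𝒟c₁ := W.clearedEval (e + 1) (Polynomial.derivative D) with h𝒟c₁
  set 𝒟c₂ := W.clearedEval e (Polynomial.derivative (Polynomial.derivative D)) with h𝒟c₂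
  set ℱ₂ := W.clearedEval 2 (Polynomial.derivative f) with hℱ₂
  set 𝒰 := W.clearedEval (2 * (e + 2) + 1) U with h𝒰
  set 𝒟cinv := 𝒟c.invOfUnit 1 with h𝒟cinvdef
  have h𝒟c0 : constantCoeff 𝒟c = 1 := by rw [h𝒟c, W.constantCoeff_clearedEval hD, hD1]
  have h𝒟𝒟 : 𝒟c * 𝒟cinv = 1 := PowerSeries.mul_invOfUnit 𝒟c 1 (by rw [h𝒟c0, Units.val_one])
  have hD' : (Polynomial.derivative D).natDegree ≤ e + 1 := (Polynomial.natDegree_derivative_le D).trans (by omega)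
  have hD'' : (Polynomial.derivative (Polynomial.derivative D)).natDegree ≤ e :=
    (Polynomial.natDegree_derivative_le _).trans (by omega)
  -- cleared relations
  have CD : W.clearedDeriv (2 * (e + 2)) 𝒟c = -2 * Xs * 𝒟c₁ := W.clearedDeriv_clearedEval_eq_derivative hD
  have R𝒟 : X * d⁄dX K 𝒟c - ((2 * (e + 2) : ℕ) : K⟦X⟧) * 𝒟c = -2 * Xs * 𝒟c₁ * Wd :=
    W.X_mul_derivative_clearedEval_sub hD
  have R𝒟₁ : X * d⁄dX K 𝒟c₁ - ((2 * (e + 1) : ℕ) : K⟦X⟧) * 𝒟c₁ = -2 * Xs * 𝒟c₂ * Wd :=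
    W.X_mul_derivative_clearedEval_sub hD'
  have RX : X * d⁄dX K Xs - 2 * Xs = -2 * Xs * Wd := by
    have h2 := W.formalEta_mul_sub_of_isCharNeTwoNF
    have hηW := W.formalEta_mul_formalInvDiff
    linear_combination Wd * h2 - (X * d⁄dX K Xs - 2 * Xs) * hηW
  have R3 : ℱ₂ * Wd = Xs * (1 + 2 * Wd) := W.clearedEval_derivative_rhsCubic_mul_formalInvDiff
  -- the explicit `U`, cleared
  have hUc : 𝒰 = C (((2 * (e + 2) + 1 : ℕ) : K)) * Xs * 𝒟c ^ 2 - 2 * ℱ₂ * 𝒟c * 𝒟c₁ + 4 * Xs ^ 2 * 𝒟c₁ ^ 2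
      - 4 * Xs ^ 2 * 𝒟c * 𝒟c₂ - C T' * X ^ 2 * 𝒟c ^ 2 := by
    have hD2 : (D ^ 2).natDegree ≤ 2 * (e + 2) := Polynomial.natDegree_pow_le.trans (Nat.mul_le_mul_left 2 hD)
    have hf3 : f.natDegree ≤ 3 := W.natDegree_rhsCubic_le
    have hf' : (Polynomial.derivative f).natDegree ≤ 2 := (Polynomial.natDegree_derivative_le f).trans (by
      have := W.natDegree_rhsCubic_le; omega)
    have h2 : (2 : Polynomial K) = Polynomial.C 2 := (Polynomial.C_ofNat 2).symm
    have h4 : (4 : Polynomial K) = Polynomial.C 4 := (Polynomial.C_ofNat 4).symm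
    have h2f' : (Polynomial.C (2 : K) * Polynomial.derivative f).natDegree ≤ 2 :=
      (Polynomial.natDegree_C_mul_le _ _).trans hf'
    have h4f : (Polynomial.C (4 : K) * f).natDegree ≤ 3 := (Polynomial.natDegree_C_mul_le _ _).trans hf3
    have hD'2 : (Polynomial.derivative D ^ 2).natDegree ≤ 2 * (e + 1) :=
      Polynomial.natDegree_pow_le.trans (Nat.mul_le_mul_left 2 hD')
    have hT1 : W.clearedEval (2 * (e + 2) + 1) (Polynomial.C (((2 * (e + 2) + 1 : ℕ) : K)) * Polynomial.X * D ^ 2) =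
        C (((2 * (e + 2) + 1 : ℕ) : K)) * (Xs * 𝒟c ^ 2) := by
      rw [mul_assoc, clearedEval_C_mul, W.clearedEval_X_mul hD2, clearedEval_pow _ hD 2]
    have hT2 : W.clearedEval (2 * (e + 2) + 1) (2 * Polynomial.derivative f * D * Polynomial.derivative D) =
        2 * ℱ₂ * 𝒟c * 𝒟c₁ := by
      rw [h2, show 2 * (e + 2) + 1 = (2 + (e + 2)) + (e + 1) by ring,
        W.clearedEval_mul ((Polynomial.natDegree_mul_le.trans (add_le_add h2f' hD))) hD',
        W.clearedEval_mul h2f' hD, clearedEval_C_mul, map_ofNat]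
    have hT3 : W.clearedEval (2 * (e + 2) + 1) (4 * f * Polynomial.derivative D ^ 2) = 4 * Xs ^ 2 * 𝒟c₁ ^ 2 := by
      rw [h4, show 2 * (e + 2) + 1 = 3 + 2 * (e + 1) by ring, W.clearedEval_mul h4f hD'2, clearedEval_pow _ hD' 2,
        clearedEval_C_mul, clearedEval_rhsCubic_eq_sq, map_ofNat]
    have hT4 : W.clearedEval (2 * (e + 2) + 1) (4 * f * D * Polynomial.derivative (Polynomial.derivative D)) =
        4 * Xs ^ 2 * 𝒟c * 𝒟c₂ := by
      rw [h4, show 2 * (e + 2) + 1 = (3 + (e + 2)) + e by ring,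
        W.clearedEval_mul ((Polynomial.natDegree_mul_le.trans (add_le_add h4f hD))) hD'',
        W.clearedEval_mul h4f hD, clearedEval_C_mul, clearedEval_rhsCubic_eq_sq, map_ofNat]
    have hT5 : W.clearedEval (2 * (e + 2) + 1) (Polynomial.C T' * D ^ 2) = X ^ 2 * (C T' * 𝒟c ^ 2) := by
      rw [W.clearedEval_add_right 1 (((Polynomial.natDegree_C_mul_le _ _).trans hD2)), clearedEval_C_mul,
        clearedEval_pow _ hD 2]
    rw [h𝒰, hUexp, clearedEval_sub, clearedEval_sub, clearedEval_add, clearedEval_sub, hT1, hT2, hT3, hT4, hT5]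
    ring
  -- assemble
  have hdinv : d⁄dX K 𝒟cinv = -d⁄dX K 𝒟c * 𝒟cinv ^ 2 := by
    have h2 := congrArg (d⁄dX K) h𝒟𝒟
    rw [Derivation.leibniz, Derivation.map_one_eq_zero, smul_eq_mul, smul_eq_mul] at h2
    linear_combination 𝒟cinv * h2 - d⁄dX K 𝒟cinv * h𝒟𝒟
  have hdCd : d⁄dX K (-2 * Xs * 𝒟c₁) = -2 * (d⁄dX K Xs * 𝒟c₁ + Xs * d⁄dX K 𝒟c₁) := by
    rw [Derivation.leibniz, Derivation.leibniz, smul_eq_mul, smul_eq_mul, smul_eq_mul,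
      show d⁄dX K (-2 : K⟦X⟧) = 0 from by rw [show (-2 : K⟦X⟧) = C (-2 : K) by rw [map_neg, map_ofNat], derivative_C]]
    ring
  have hc1 : ((2 * (e + 1) : ℕ) : K⟦X⟧) = 2 * (e : K⟦X⟧) + 2 := by push_cast; ring
  have hc2 : ((2 * (e + 2) : ℕ) : K⟦X⟧) = 2 * (e : K⟦X⟧) + 4 := by push_cast; ring
  have hc3 : (C (((2 * (e + 2) + 1 : ℕ) : K)) : K⟦X⟧) = 2 * (e : K⟦X⟧) + 5 := by
    rw [map_natCast]; push_cast; ring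
  rw [hc1] at R𝒟₁
  rw [hc2] at R𝒟
  rw [CD, Derivation.leibniz, smul_eq_mul, smul_eq_mul, hdinv, hdCd, hUc, hc3]
  linear_combination 2 * Xs * 𝒟c₁ * 𝒟cinv ^ 2 * R𝒟 - 2 * 𝒟c₁ * 𝒟cinv * RX - 2 * Xs * 𝒟cinv * R𝒟₁
    - 2 * 𝒟c₁ * 𝒟cinv * R3
    + (-(X ^ 2 * Wd * C T' * (𝒟c * 𝒟cinv + 1)) + (4 * (e : K⟦X⟧) + 8) * Xs * 𝒟c₁ * 𝒟cinv
        + Xs * Wd * (2 * (e : K⟦X⟧) + 5) * (𝒟c * 𝒟cinv + 1) - 4 * Xs ^ 2 * 𝒟cinv * Wd * 𝒟c₂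
        - 2 * 𝒟c₁ * 𝒟cinv * Wd * ℱ₂) * h𝒟𝒟

end IsogenyData

end WeierstrassCurve
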